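import Mathlib.FieldTheory.Galois.Basic
import Mathlib.FieldTheory.IntermediateField.Algebraic
import Literature.NumberTheory.EllipticCurves.IsogenyMulProofs
import Literature.NumberTheory.EllipticCurves.FunctionFieldTranslation
import Literature.NumberTheory.EllipticCurves.TorsionCardinality
import Literature.NumberTheory.EllipticCurves.PointDivisibilityProofs
import Literature.NumberTheory.EllipticCurves.IsogenyHom
import HarnessLib

/-!
# `deg [m] = m²`, `[m]^* K̄(E) = K̄(E)^{E[m]}`, and isogenies killing `E[m]` factor through `[m]`

Trunk T-ELLARITH (group G16); notion `cm_endomorphisms_isogeny`. A *proofs* file (theorems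
only) on top of the multiplication-by-`m` isogeny `WeierstrassCurve.Isogeny.zsmul W m hm`
(`IsogenyMulProofs`) and the function-field calculus of `FunctionFieldTranslation`
(values `HasValueAt`, translations `τ_T^*`, `transHom`) and `IsogenyDegree`
(`pullbackX/Y`, `pullbackField = φ^* K̄(E')`, `deg φ = [K̄(E) : φ^* K̄(E')]`). It **discharges the
named fact**

* `WeierstrassCurve.Isogeny.exists_eq_comp_nsmul_of_geomTorsion_le_ker W W'` (`IsogenyHom.lean`;
  Silverman, *AEC*, Cor. III.4.11 applied to the separable isogeny `[m]`, Cor. III.5.4): for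
  elliptic curves `E, E'` over any field `K`, `m ≠ 0` in `K` and an isogeny `ψ : E → E'` over `K`
  with `E[m] ⊆ ker ψ`, there is an isogeny `λ : E → E'` over `K` with `ψ = λ ∘ [m]`
  (`Isogeny.exists_eq_comp_nsmul_of_geomTorsion_le_ker_holds'`; the unprimed name belongs to
  the independent, simultaneous discharge in `IsogenyHomNsmulProofs`, by symmetric functions —
  the two files can be imported together),

a hypothesis of the degree route to *AEC* III.7.4 (`FaltingsECProofs`,
`FaltingsECTateLemma1Proofs`, `FaltingsECTateFiniteProofs`) and of the reductions of Faltings'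
Satz 4 for elliptic curves (`FaltingsECEndomorphismsProofs`, `FaltingsECSubspaces`), and proves
on the way

* `WeierstrassCurve.Isogeny.deg_zsmul`: **`deg [m] = m²`** for `m ≠ 0` in `K` (Silverman, *AEC*,
  Thm. III.6.2(d)), over the genuine degree of `IsogenyDegree`;
* `WeierstrassCurve.Isogeny.pullbackField_zsmul_eq_fixedField`: **`[m]^* K̄(E) = K̄(E)^{E[m]}`**,
  the fixed field of the translations by `E[m]` (i.e. `K̄(E) / [m]^* K̄(E)` is Galois with group
  `E[m]`; Silverman, *AEC*, Thm. III.4.10(b) for `φ = [m]`).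

## The argument

Silverman proves III.4.11 by Galois theory of function fields: `τ_T^*` (`T ∈ ker φ`) fixes
`ψ^* K̄(E₂)`, and `K̄(E₁)^{ker φ} = φ^* K̄(E₁)` because `φ` is separable with
`#ker φ = deg φ` (III.4.10); hence `ψ^* K̄(E₂) ⊆ φ^* K̄(E₁)`, which gives a rational map `λ` with
`λ ∘ φ = ψ`, a morphism by II.2.1. Here `φ = [m]`, and the one input from the theory of
separability — `[K̄(E) : [m]^* K̄(E)] = #E[m]` — is obtained by a degree count instead:

1. *Upper bound* `[K̄(E) : [m]^* K̄(E)] ≤ m²` (`finiteDimensional_pullbackField_zsmul`):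
   `x` is a root of `Φₘ(T) - ([m]^* x) ΨSqₘ(T)`, of degree `m²` over `K̄([m]^* x)`
   (`[m]^* x = Φₘ(x)/ΨSqₘ(x)`, *AEC* Exercise 3.7(d); `pullbackX_zsmul_mul_aeval_ΨSq`,
   `isIntegral_genX_adjoin_pullbackX_zsmul`), and `y` is quadratic over `K̄([m]^* x, x)`, so
   `[K̄(E) : K̄([m]^* x)] ≤ 2m²` (`finrank_adjoin_pullbackX_zsmul_le`); and
   `[K̄([m]^* x, [m]^* y) : K̄([m]^* x)] ≥ 2` because `[m]^* y ∉ K̄([m]^* x)`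
   (`pullbackY_zsmul_not_mem_adjoin_pullbackX`: an element of `K̄([m]^* x)` takes the same value
   at `P` and `-P`, while `y(mP) = y(-mP)` would force `2mP = O` for almost all `P`).
2. *Lower bound* `m² = #E[m] ∣ [K̄(E) : [m]^* K̄(E)]` for `m ≠ 0` in `K`: the tree's
   `card_torsionPoints_eq_sq_holds` (*AEC* III.6.4(b), through `Isogeny.degree_zsmul`) and
   `Isogeny.card_ker_dvd_deg_holds` (Artin's theorem on the translations, *AEC* III.4.10).
3. Hence `deg [m] = m²` and `[m]^* K̄(E) = K̄(E)^{E[m]}` (`IntermediateField.eq_of_le_of_finrank_eq'`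
   with `Isogeny.pullbackField_le_fixedField`).
4. *Descent* (`Isogeny.exists_pullback_eq_of_geomTorsion_le_ker`): for `E[m] ⊆ ker ψ`,
   `ψ^* x', ψ^* y' ∈ K̄(E)^{ker ψ} ⊆ K̄(E)^{E[m]} = [m]^* K̄(E)`, and `[m]^* K̄(E)` is the image of
   the `K̄`-algebra endomorphism `[m]^* : K̄(E) → K̄(E)` sending the generic point `(x, y)` to
   `([m]^* x, [m]^* y)` (`exists_algHom_map_genericPoint_eq_genericImage_zsmul`, from
   `FunctionFieldTranslation.exists_algHom_map_genericPoint_eq`; its image is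
   `K̄([m]^* x, [m]^* y)` by `IntermediateField.adjoin_map`, as `K̄(E) = K̄(x, y)`), so
   `ψ^* x' = [m]^* w₁`, `ψ^* y' = [m]^* w₂`.
5. *The point map* `λ = ψ ∘ [m]⁻¹` (`exists_addMonoidHom_comp_zsmul_eq`, Mathlib
   `AddMonoidHom.liftOfSurjective`; `[m]` is onto `E(K̄)` by the tree's
   `zsmul_geomPoints_surjective_holds`) agrees with the rational map `(w₁, w₂) = (g₁/h₁, g₂/h₂)`
   off a finite set (`isAlgebraicOn_of_comp_zsmul_eq`: compare the values of `ψ^* x'` and of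
   `[m]^* w₁` at a good `Q` with `mQ = P`), is `Γ_K`-equivariant since `[m]` and `ψ` are, and has
   finite kernel being algebraic (`IsAlgebraicOn.finite_ker`): it is an `Isogeny W W'`.

## Contents (all proved; no definitions)

Values: `RationalRep.hasValueAt_pullbackX/Y`, `hasValueAt_pullbackX/Y_zsmul`,
`HasValueAt.polynomial_aeval`, `hasValueAt_aeval_genX`, `geomPoints.xy_neg_zero`,
`pullbackX_zsmul_mul_aeval_ΨSq`. Degrees: `isIntegral_genX_adjoin_pullbackX_zsmul`,
`adjoin_genX_genY_eq_top`, `finrank_adjoin_pullbackX_zsmul_le`,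
`exists_finite_hasValueAt_neg_of_mem_adjoin_simple`, `geomPoints.two_smul_eq_zero_of_xy_neg_one`,
`exists_finite_hasValueAt_neg_pullbackX_zsmul`, `pullbackY_zsmul_not_mem_adjoin_pullbackX`,
`transcendental_pullbackX_zsmul`, `genericImage_zsmul_ne_constPoint`,
`adjoin_pullbackX_le_pullbackField`, `finiteDimensional_pullbackField_zsmul`,
`Isogeny.deg_zsmul`, `Isogeny.pullbackField_zsmul_eq_fixedField`. Factorisation:
`exists_algHom_map_genericPoint_eq_genericImage_zsmul`,
`exists_algHom_apply_eq_of_mem_pullbackField_zsmul`,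
`Isogeny.exists_pullback_eq_of_geomTorsion_le_ker`, `hasValueAt_algHom_evalGeneric_div`,
`exists_addMonoidHom_comp_zsmul_eq`, `isAlgebraicOn_of_comp_zsmul_eq`,
`Isogeny.exists_eq_comp_zsmul_of_geomTorsion_le_ker`,
`Isogeny.exists_eq_comp_nsmul_of_geomTorsion_le_ker_holds'`.

## References

* [SilvermanAEC2009] J. H. Silverman, *The Arithmetic of Elliptic Curves*, 2nd ed., GTM 106,
  Springer 2009: II.§2 (function fields, `φ^*`, Thm. II.2.4), III.§4 (Thm. III.4.10, Cor. III.4.11),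
  III.§5 (Cor. III.5.4), III.§6 (Thm. III.6.2(d), Cor. III.6.4(b)), Exercise 3.7.

## Design

`noncomputable section`, `open scoped Classical`, deliberate dot-notation extensions in
`namespace WeierstrassCurve` (as the prelude `Isogeny` and its proofs files). `m : ℤ` throughout
(`Isogeny.zsmul`); the discharge specialises to the fact's `m : ℕ` at the end. No statement of the
tree is modified.
-/

noncomputable section

open scoped Classical

universe u

namespace WeierstrassCurve

open geomPoints Literature.NumberTheory.EllipticCurves Polynomial

variable {K : Type u} [Field K] {W W' : WeierstrassCurve K}

/-! ## Values of pull-backs at points of agreement -/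

section Values

/-- **`(x' ∘ f)(P) = x'(f P)`**: at a point `P` where `f` agrees with its rational representation,
the pull-back `r.pullbackX = P₁(x, y)/Q₁(x, y)` has the value `x'(f P)`. [folklore] -/
theorem RationalRep.hasValueAt_pullbackX {f : W.geomPoints → W'.geomPoints} (r : RationalRep W W' f)
    {P : W.geomPoints} (hA : AgreesWithRationalMapAt W W' r.P₁ r.Q₁ r.P₂ r.Q₂ f P) :
    W.HasValueAt r.pullbackX P (xy (f P) 0) := by
  obtain ⟨hP0, hQ₁, -, h', e⟩ := agreesWithRationalMapAt_iff.mp hA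
  rw [e, xy_some, Matrix.cons_val_zero]
  exact hasValueAt_div hP0 hQ₁

/-- **`(y' ∘ f)(P) = y'(f P)`** at a point of agreement. [folklore] -/
theorem RationalRep.hasValueAt_pullbackY {f : W.geomPoints → W'.geomPoints} (r : RationalRep W W' f)
    {P : W.geomPoints} (hA : AgreesWithRationalMapAt W W' r.P₁ r.Q₁ r.P₂ r.Q₂ f P) :
    W.HasValueAt r.pullbackY P (xy (f P) 1) := by
  obtain ⟨hP0, -, hQ₂, h', e⟩ := agreesWithRationalMapAt_iff.mp hA
  rw [e, xy_some]
  exact hasValueAt_div hP0 hQ₂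

variable [W.IsElliptic]

/-- **`([m]^* x)(P) = x(m • P)`** for `m • P ≠ O`. Silverman, *AEC*, Exercise 3.7(d). [folklore] -/
theorem hasValueAt_pullbackX_zsmul {m : ℤ} (hm : m ≠ 0) {P : W.geomPoints} (hP : m • P ≠ 0) :
    W.HasValueAt (Isogeny.zsmul W m hm).pullbackX P (xy (m • P) 0) := by
  rw [Isogeny.pullbackX_eq _ (W.zsmulRationalRep m hm)]
  exact (W.zsmulRationalRep m hm).hasValueAt_pullbackX (agreesWithRationalMapAt_zsmul W hP)

/-- **`([m]^* y)(P) = y(m • P)`** for `m • P ≠ O`. Silverman, *AEC*, Exercise 3.7(d). [folklore] -/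
theorem hasValueAt_pullbackY_zsmul {m : ℤ} (hm : m ≠ 0) {P : W.geomPoints} (hP : m • P ≠ 0) :
    W.HasValueAt (Isogeny.zsmul W m hm).pullbackY P (xy (m • P) 1) := by
  rw [Isogeny.pullbackY_eq _ (W.zsmulRationalRep m hm)]
  exact (W.zsmulRationalRep m hm).hasValueAt_pullbackY (agreesWithRationalMapAt_zsmul W hP)

end Values

/-! ## Values of polynomials in a function; the identity `[m]^* x · Ψₘ²(x) = Φₘ(x)` -/

section PolyValues

variable {z : W.geomFunctionField} {P : W.geomPoints} {c : AlgebraicClosure K}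

/-- A polynomial `q(z)` in a function `z` regular at `P` with value `c` has value `q(c)` at `P`.
[folklore] -/
theorem HasValueAt.polynomial_aeval (hz : W.HasValueAt z P c) (q : (AlgebraicClosure K)[X]) :
    W.HasValueAt (Polynomial.aeval z q) P (q.eval c) := by
  induction q using Polynomial.induction_on' with
  | add p q hp hq => simpa using hp.add hq
  | monomial n a =>
    rw [Polynomial.aeval_monomial, Polynomial.eval_monomial]
    exact (hasValueAt_algebraMap a P).mul (hz.pow n)

/-- `q(x)` has value `q(x(P))` at `P`. [folklore] -/
theorem hasValueAt_aeval_genX (q : (AlgebraicClosure K)[X]) (P : W.geomPoints) :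
    W.HasValueAt (aeval W.genX q) P (q.eval (xy P 0)) := by
  simpa using (hasValueAt_gen P 0).polynomial_aeval q

/-- The `x`-coordinate of `-Q` is that of `Q`. [folklore] -/
theorem geomPoints.xy_neg_zero (Q : W.geomPoints) : xy (-Q) 0 = xy Q 0 := by
  rcases Q with _ | ⟨a, b, h⟩
  · rfl
  · rfl

variable [W.IsElliptic]

/-- **`[m]^* x · ΨSqₘ(x) = Φₘ(x)` in `K̄(E)`** (Silverman, *AEC*, Exercise 3.7(d),
`x([m]P) = φₘ(P)/ψₘ(P)²` with `ψₘ² ≡ ΨSqₘ(x)`, `φₘ ≡ Φₘ(x)`): both sides have the value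
`x(mP) ΨSqₘ(x(P)) = Φₘ(x(P))` (the tree's `mul_eval_ΨSq_of_zsmul_eq`) at every `P ∉ E[m]`.
[cite: SilvermanAEC2009, Exercise 3.7(d)] -/
theorem pullbackX_zsmul_mul_aeval_ΨSq {m : ℤ} (hm : m ≠ 0) :
    (Isogeny.zsmul W m hm).pullbackX *
        aeval W.genX ((W.baseChange (AlgebraicClosure K)).ΨSq m) =
      aeval W.genX ((W.baseChange (AlgebraicClosure K)).Φ m) := by
  apply eq_of_infinite_setOf_hasValueAt
  refine ((finite_geomTorsion W hm).infinite_compl).mono fun P hP ↦ ?_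
  have hPm : m • P ≠ 0 := fun h ↦ hP ((mem_torsionPoints_iff _ _ P).mpr h)
  have hP0 : P ≠ 0 := by
    rintro rfl
    exact hPm (smul_zero m)
  refine ⟨hP0, _, (hasValueAt_pullbackX_zsmul hm hPm).mul (hasValueAt_aeval_genX _ P),
    (hasValueAt_aeval_genX _ P).congr rfl ?_⟩
  obtain ⟨x₀, y₀, h, rfl⟩ := geomPoints.exists_eq_some hP0
  obtain ⟨x₁, y₁, h₁, e⟩ := geomPoints.exists_eq_some hPm
  rw [e, xy_some, xy_some]
  simp only [Matrix.cons_val_zero]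
  exact (mul_eval_ΨSq_of_zsmul_eq (W := W.baseChange (AlgebraicClosure K)) h m h₁ e).symm

end PolyValues

/-! ## `[K̄(E) : K̄([m]^* x)] ≤ 2m²` -/

section DegreeBound

variable [W.IsElliptic] {m : ℤ} (hm : m ≠ 0)

/-- **`x` is algebraic of degree `≤ m²` over `K̄([m]^* x)`**: it is a root of
`Φₘ(T) - ([m]^* x) ΨSqₘ(T)`, a polynomial of degree `m²` with leading coefficient `1` (`Φₘ` is
monic of degree `m²`, `deg ΨSqₘ ≤ m² - 1`; Mathlib `WeierstrassCurve.coeff_Φ`,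
`natDegree_ΨSq_le`). This is the easy half of `[K̄(x) : K̄(Φₘ(x)/ΨSqₘ(x))] = m²`.
Silverman, *AEC*, Exercise 3.7(b),(d). [folklore] -/
theorem isIntegral_genX_adjoin_pullbackX_zsmul :
    _root_.IsIntegral
        (IntermediateField.adjoin (AlgebraicClosure K) {(Isogeny.zsmul W m hm).pullbackX}) W.genX ∧
      (minpoly (IntermediateField.adjoin (AlgebraicClosure K) {(Isogeny.zsmul W m hm).pullbackX})
        W.genX).natDegree ≤ m.natAbs ^ 2 := by
  set L₀ := IntermediateField.adjoin (AlgebraicClosure K) {(Isogeny.zsmul W m hm).pullbackX}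
    with hL₀
  set xm := (Isogeny.zsmul W m hm).pullbackX with hxm
  have hxmL : xm ∈ L₀ := IntermediateField.mem_adjoin_simple_self _ xm
  set p : L₀[X] := ((W.baseChange (AlgebraicClosure K)).Φ m).map (algebraMap _ L₀) -
    C (⟨xm, hxmL⟩ : L₀) * ((W.baseChange (AlgebraicClosure K)).ΨSq m).map (algebraMap _ L₀)
    with hp
  have hp_eval : aeval W.genX p = 0 := by
    rw [hp, map_sub, map_mul, aeval_map_algebraMap, aeval_map_algebraMap, aeval_C,
      IntermediateField.algebraMap_apply]
    change aeval W.genX _ - xm * _ = 0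
    rw [← pullbackX_zsmul_mul_aeval_ΨSq hm, sub_self]
  have hΨ : ((W.baseChange (AlgebraicClosure K)).ΨSq m).coeff (m.natAbs ^ 2) = 0 := by
    apply coeff_eq_zero_of_natDegree_lt
    refine (natDegree_ΨSq_le _ m).trans_lt ?_
    have : 0 < m.natAbs ^ 2 := pow_pos (Int.natAbs_pos.mpr hm) 2
    omega
  have hp_coeff : p.coeff (m.natAbs ^ 2) = 1 := by
    rw [hp, coeff_sub, coeff_C_mul, coeff_map, coeff_map, coeff_Φ, hΨ]
    simp
  have hp0 : p ≠ 0 := fun h ↦ by simp [h] at hp_coeff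
  have hpdeg : p.natDegree ≤ m.natAbs ^ 2 := by
    rw [hp]
    refine (natDegree_sub_le _ _).trans (max_le ?_ ?_)
    · exact (natDegree_map_le).trans (natDegree_Φ_le _ m)
    · refine natDegree_C_mul_le _ _ |>.trans ((natDegree_map_le).trans ?_)
      exact (natDegree_ΨSq_le _ m).trans (Nat.sub_le _ _)
  have halg : _root_.IsAlgebraic L₀ W.genX := ⟨p, hp0, hp_eval⟩
  refine ⟨halg.isIntegral, ?_⟩
  exact (natDegree_le_natDegree (minpoly.degree_le_of_ne_zero L₀ W.genX hp0 hp_eval)).trans hpdeg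

omit [W.IsElliptic] in
/-- `K̄(E)` is generated over `K̄` by `x` and `y`. [folklore] -/
theorem adjoin_genX_genY_eq_top :
    IntermediateField.adjoin (AlgebraicClosure K) {W.genX, W.genY} = ⊤ := by
  rw [eq_top_iff]
  intro z _
  obtain ⟨g, h, -, rfl⟩ := exists_eq_evalGeneric_div z
  have hmem : ∀ g : MvPolynomial (Fin 2) (AlgebraicClosure K), W.evalGeneric g ∈
      IntermediateField.adjoin (AlgebraicClosure K) {W.genX, W.genY} := by
    intro g
    rw [evalGeneric_eq_aeval]
    have hr : (MvPolynomial.aeval ![W.genX, W.genY] :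
        MvPolynomial (Fin 2) (AlgebraicClosure K) →ₐ[AlgebraicClosure K] W.geomFunctionField).range ≤
        (IntermediateField.adjoin (AlgebraicClosure K) {W.genX, W.genY}).toSubalgebra := by
      rw [← Algebra.adjoin_range_eq_range_aeval]
      refine Algebra.adjoin_le ?_
      rintro _ ⟨i, rfl⟩
      fin_cases i
      · exact IntermediateField.subset_adjoin _ _ (by simp)
      · exact IntermediateField.subset_adjoin _ _ (by simp)
    exact hr ⟨g, rfl⟩
  exact div_mem (hmem g) (hmem h)

end DegreeBound


section Tower

variable [W.IsElliptic] {m : ℤ} (hm : m ≠ 0)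

/-- **`[K̄(E) : K̄([m]^* x)] ≤ 2m²`** and the extension is finite: `K̄([m]^* x) ⊆ K̄([m]^* x, x)`
has degree `≤ m²` (`isIntegral_genX_adjoin_pullbackX_zsmul`) and `K̄(E) = K̄([m]^* x, x)(y)` with
`y` a root of the (monic, quadratic) Weierstrass equation over `K̄(x)`. Silverman, *AEC*,
III.§1–2 (`[K̄(E) : K̄(x)] = 2`) with Exercise 3.7. [folklore] -/
theorem finrank_adjoin_pullbackX_zsmul_le :
    FiniteDimensional
        (IntermediateField.adjoin (AlgebraicClosure K) {(Isogeny.zsmul W m hm).pullbackX})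
        W.geomFunctionField ∧
      Module.finrank
        (IntermediateField.adjoin (AlgebraicClosure K) {(Isogeny.zsmul W m hm).pullbackX})
        W.geomFunctionField ≤ 2 * m.natAbs ^ 2 := by
  set L₀ := IntermediateField.adjoin (AlgebraicClosure K) {(Isogeny.zsmul W m hm).pullbackX}
    with hL₀
  obtain ⟨hint, hdeg⟩ := isIntegral_genX_adjoin_pullbackX_zsmul (W := W) hm
  set L₁ : IntermediateField L₀ W.geomFunctionField := IntermediateField.adjoin L₀ {W.genX}
    with hL₁
  haveI hST : IsScalarTower (AlgebraicClosure K) L₁ W.geomFunctionField :=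
    IsScalarTower.of_algebraMap_eq fun _ ↦ rfl
  haveI hfin₁ : FiniteDimensional L₀ L₁ := IntermediateField.adjoin.finiteDimensional hint
  have h1 : Module.finrank L₀ L₁ ≤ m.natAbs ^ 2 := by
    rw [hL₁, IntermediateField.adjoin.finrank hint]
    exact hdeg
  -- `y` over `L₁`: root of the Weierstrass polynomial with `x ∈ L₁` substituted
  have hxL₁ : W.genX ∈ L₁ := IntermediateField.mem_adjoin_simple_self L₀ W.genX
  set q : L₁[X] := ((W.baseChange (AlgebraicClosure K)).toAffine.polynomial).map
    (eval₂RingHom (algebraMap (AlgebraicClosure K) L₁) ⟨W.genX, hxL₁⟩) with hq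
  have hqm : q.Monic := (Affine.monic_polynomial (W := _)).map _
  have hqdeg : q.natDegree = 2 := by
    rw [hq, (Affine.monic_polynomial (W := _)).natDegree_map, Affine.natDegree_polynomial]
  have hqy : aeval W.genY q = 0 := by
    rw [aeval_def, hq, eval₂_map]
    have hcomp : (algebraMap L₁ W.geomFunctionField).comp
        (eval₂RingHom (algebraMap (AlgebraicClosure K) L₁) ⟨W.genX, hxL₁⟩) =
        eval₂RingHom (algebraMap (AlgebraicClosure K) W.geomFunctionField) W.genX := by
      refine Polynomial.ringHom_ext (fun a ↦ ?_) ?_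
      · simp only [RingHom.coe_comp, Function.comp_apply, coe_eval₂RingHom, eval₂_C]
        exact (IsScalarTower.algebraMap_apply (AlgebraicClosure K) L₁ W.geomFunctionField a).symm
      · simp only [RingHom.coe_comp, Function.comp_apply, coe_eval₂RingHom, eval₂_X]
        rfl
    rw [hcomp, eval₂_eval₂RingHom_apply, ← baseChange_geomFunctionField_polynomial]
    exact equation_genX_genY W
  have hyint : _root_.IsIntegral L₁ W.genY := ⟨q, hqm, by rwa [aeval_def] at hqy⟩
  have h2 : Module.finrank L₁ (IntermediateField.adjoin L₁ {W.genY}) ≤ 2 := by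
    rw [IntermediateField.adjoin.finrank hyint, ← hqdeg]
    exact natDegree_le_natDegree (minpoly.degree_le_of_ne_zero L₁ W.genY hqm.ne_zero hqy)
  -- `L₁(y) = K̄(E)`
  have htop : IntermediateField.adjoin L₁ {W.genY} = ⊤ := by
    rw [eq_top_iff]
    intro z _
    have hle : IntermediateField.adjoin (AlgebraicClosure K) {W.genX, W.genY} ≤
        (IntermediateField.adjoin L₁ {W.genY}).restrictScalars (AlgebraicClosure K) := by
      rw [IntermediateField.adjoin_le_iff]
      rintro w (rfl | hw)
      · change W.genX ∈ IntermediateField.adjoin L₁ {W.genY}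
        exact (IntermediateField.algebraMap_mem (IntermediateField.adjoin L₁ {W.genY})
          (⟨W.genX, hxL₁⟩ : L₁))
      · rw [Set.mem_singleton_iff.mp hw]
        exact IntermediateField.mem_adjoin_simple_self L₁ W.genY
    have hz : z ∈ (IntermediateField.adjoin L₁ {W.genY}).restrictScalars (AlgebraicClosure K) :=
      hle (by rw [adjoin_genX_genY_eq_top]; trivial)
    exact hz
  haveI hfin₂ : FiniteDimensional L₁ (IntermediateField.adjoin L₁ {W.genY}) :=
    IntermediateField.adjoin.finiteDimensional hyint
  haveI hfin₃ : FiniteDimensional L₁ W.geomFunctionField := by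
    rw [htop] at hfin₂
    exact LinearEquiv.finiteDimensional
      (IntermediateField.topEquiv (F := L₁) (E := W.geomFunctionField)).toLinearEquiv
  have h3 : Module.finrank L₁ W.geomFunctionField ≤ 2 := by
    rw [htop, IntermediateField.finrank_top'] at h2
    exact h2
  refine ⟨Module.Finite.trans L₁ W.geomFunctionField, ?_⟩
  haveI : Module.Free L₀ L₁ := Module.Free.of_divisionRing L₀ L₁
  haveI : Module.Free L₁ W.geomFunctionField := Module.Free.of_divisionRing L₁ _
  rw [← Module.finrank_mul_finrank L₀ L₁ W.geomFunctionField]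
  calc Module.finrank L₀ L₁ * Module.finrank L₁ W.geomFunctionField
      ≤ m.natAbs ^ 2 * 2 := Nat.mul_le_mul h1 h3
    _ = 2 * m.natAbs ^ 2 := by ring

end Tower

/-! ## `[m]^* y ∉ K̄([m]^* x)`: the parity argument -/

section Parity

variable {u z : W.geomFunctionField}

/-- If `u` has, off a finite set, the same value at `P` and at `-P`, then so does every element of
`K̄(u)` (a quotient `r(u)/s(u)`; the zeros of `s(u) ≠ 0` are finitely many). [folklore] -/
theorem exists_finite_hasValueAt_neg_of_mem_adjoin_simple
    (hu : ∃ S : Set W.geomPoints, S.Finite ∧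
      ∀ P ∉ S, ∃ c, W.HasValueAt u P c ∧ W.HasValueAt u (-P) c)
    (hz : z ∈ IntermediateField.adjoin (AlgebraicClosure K) {u}) :
    ∃ S : Set W.geomPoints, S.Finite ∧
      ∀ P ∉ S, ∃ c, W.HasValueAt z P c ∧ W.HasValueAt z (-P) c := by
  obtain ⟨S, hS, hSu⟩ := hu
  rw [IntermediateField.mem_adjoin_simple_iff] at hz
  obtain ⟨r, s, rfl⟩ := hz
  by_cases hs : aeval u s = 0
  · refine ⟨∅, Set.finite_empty, fun P _ ↦ ⟨0, ?_, ?_⟩⟩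
    · rw [hs, div_zero]; exact hasValueAt_zero P
    · rw [hs, div_zero]; exact hasValueAt_zero (-P)
  -- the zeros of `s(u)` are finite
  have hZ : {P : W.geomPoints | P ≠ 0 ∧ W.HasValueAt (aeval u s) P 0}.Finite :=
    Set.not_infinite.mp fun hinf ↦ hs (eq_zero_of_infinite_setOf_hasValueAt_zero hinf)
  refine ⟨S ∪ {0} ∪ {P | P ≠ 0 ∧ W.HasValueAt (aeval u s) P 0}, (hS.union (by simp)).union hZ,
    fun P hP ↦ ?_⟩
  simp only [Set.mem_union, Set.mem_singleton_iff, Set.mem_setOf_eq, not_or, not_and] at hP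
  obtain ⟨⟨hPS, hP0⟩, hPZ⟩ := hP
  obtain ⟨c, hc, hc'⟩ := hSu P hPS
  have hsc : s.eval c ≠ 0 := fun h0 ↦ hPZ hP0 (by simpa [h0] using hc.polynomial_aeval s)
  have hnP0 : -P ≠ 0 := fun h ↦ hP0 (neg_eq_zero.mp h)
  exact ⟨r.eval c / s.eval c, (hc.polynomial_aeval r).div hP0 (hc.polynomial_aeval s) hsc,
    (hc'.polynomial_aeval r).div hnP0 (hc'.polynomial_aeval s) hsc⟩

/-- An affine point with `y(Q) = y(-Q)` is `2`-torsion (`-(a, b) = (a, -b - a₁a - a₃)`).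
Silverman, *AEC*, III.2.3. [folklore] -/
theorem geomPoints.two_smul_eq_zero_of_xy_neg_one {Q : W.geomPoints} (hQ : Q ≠ 0)
    (h : xy Q 1 = xy (-Q) 1) : (2 : ℤ) • Q = 0 := by
  obtain ⟨a, b, hab, rfl⟩ := geomPoints.exists_eq_some hQ
  have hb : b = (W.baseChange (AlgebraicClosure K)).toAffine.negY a b := h
  have hQQ : -(Affine.Point.some a b hab : W.geomPoints) = Affine.Point.some a b hab := by
    change (Affine.Point.some a ((W.baseChange (AlgebraicClosure K)).toAffine.negY a b)
      ((Affine.nonsingular_neg ..).mpr hab) : W.geomPoints) = _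
    rw [Affine.Point.some.injEq]
    exact ⟨rfl, hb.symm⟩
  rw [two_zsmul, add_eq_zero_iff_eq_neg]
  exact hQQ.symm

variable [W.IsElliptic] {m : ℤ}

/-- `[m]^* x` has the same value `x(mP) = x(-(mP))` at `P` and `-P`, for `P ∉ E[m]`. [folklore] -/
theorem exists_finite_hasValueAt_neg_pullbackX_zsmul (hm : m ≠ 0) :
    ∃ S : Set W.geomPoints, S.Finite ∧ ∀ P ∉ S, ∃ c,
      W.HasValueAt (Isogeny.zsmul W m hm).pullbackX P c ∧
        W.HasValueAt (Isogeny.zsmul W m hm).pullbackX (-P) c := by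
  refine ⟨geomTorsion W m, finite_geomTorsion W hm, fun P hP ↦ ?_⟩
  have hPm : m • P ≠ 0 := fun h ↦ hP ((mem_torsionPoints_iff _ _ P).mpr h)
  have hPm' : m • (-P) ≠ 0 := by rwa [smul_neg, neg_ne_zero]
  refine ⟨_, hasValueAt_pullbackX_zsmul hm hPm, ?_⟩
  have h := hasValueAt_pullbackX_zsmul hm hPm'
  rwa [smul_neg, geomPoints.xy_neg_zero] at h

/-- **`[m]^* y ∉ K̄([m]^* x)`.** Otherwise `[m]^* y` would have the same value at `P` and `-P`
for almost all `P` (`exists_finite_hasValueAt_neg_of_mem_adjoin_simple`), i.e.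
`y(mP) = y(-(mP))`, forcing `2mP = O` for all but finitely many `P`; but `E[2m]` is finite and
`E(K̄)` infinite. (This is the statement `[K̄(x_m, y_m) : K̄(x_m)] ≥ 2` behind `deg [m] = m²`.)
[folklore] -/
theorem pullbackY_zsmul_not_mem_adjoin_pullbackX (hm : m ≠ 0) :
    (Isogeny.zsmul W m hm).pullbackY ∉
      IntermediateField.adjoin (AlgebraicClosure K) {(Isogeny.zsmul W m hm).pullbackX} := by
  intro hmem
  obtain ⟨S, hS, hSP⟩ := exists_finite_hasValueAt_neg_of_mem_adjoin_simple
    (exists_finite_hasValueAt_neg_pullbackX_zsmul hm) hmem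
  have h2m : (2 * m : ℤ) ≠ 0 := mul_ne_zero two_ne_zero hm
  apply ((hS.union (Set.finite_singleton (0 : W.geomPoints))).union
    (finite_geomTorsion W hm)).infinite_compl
  refine (finite_geomTorsion W h2m).subset fun P hP ↦ ?_
  simp only [Set.mem_compl_iff, Set.mem_union, Set.mem_singleton_iff, SetLike.mem_coe, not_or]
    at hP
  obtain ⟨⟨hPS, hP0⟩, hPm⟩ := hP
  have hPm' : m • P ≠ 0 := fun h ↦ hPm ((mem_torsionPoints_iff _ _ P).mpr h)
  have hPmn : m • (-P) ≠ 0 := by rwa [smul_neg, neg_ne_zero]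
  have hnP0 : -P ≠ 0 := fun h ↦ hP0 (neg_eq_zero.mp h)
  obtain ⟨c, hc, hc'⟩ := hSP P hPS
  have h1 : xy (m • P) 1 = c := (hasValueAt_pullbackY_zsmul hm hPm').unique hP0 hc
  have h2 : xy (m • (-P)) 1 = c := (hasValueAt_pullbackY_zsmul hm hPmn).unique hnP0 hc'
  rw [smul_neg] at h2
  have key := geomPoints.two_smul_eq_zero_of_xy_neg_one hPm' (h1.trans h2.symm)
  exact (mem_torsionPoints_iff _ _ P).mpr (by rw [mul_smul]; exact key)

end Parity


/-! ## `[m]^* x` is transcendental -/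

section Transcendental

variable [W.IsElliptic] {m : ℤ}

/-- **`[m]^* x` is transcendental over `K̄`**: were it a constant `a` (`K̄` is algebraically closed),
`x(mP) = a` for all `P ∉ E[m]`, hence (as `[m]` is onto `E(K̄)`) `x(Q) = a` for every affine `Q`,
whereas `x - a` has finitely many zeros. [folklore] -/
theorem transcendental_pullbackX_zsmul (hm : m ≠ 0) :
    Transcendental (AlgebraicClosure K) (Isogeny.zsmul W m hm).pullbackX := by
  intro halg
  obtain ⟨a, ha⟩ := exists_algebraMap_eq_of_isAlgebraic halg
  have hx : ∀ Q : W.geomPoints, Q ≠ 0 → xy Q 0 = a := by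
    intro Q hQ
    obtain ⟨P, rfl⟩ := zsmul_geomPoints_surjective_holds W hm Q
    have hP0 : P ≠ 0 := by
      rintro rfl
      exact hQ (smul_zero m)
    exact (hasValueAt_pullbackX_zsmul hm hQ).unique hP0 (ha ▸ hasValueAt_algebraMap a P)
  have hne : W.evalGeneric (MvPolynomial.X 0 - MvPolynomial.C a) ≠ 0 := by
    rw [map_sub, evalGeneric_X_zero, evalGeneric_C, sub_ne_zero]
    intro h
    exact transcendental_genX W (h ▸ isAlgebraic_algebraMap a)
  refine geomPoints.infinite_ne_zero (W := W) ((finite_setOf_eval_xy_eq_zero hne).subset ?_)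
  intro Q hQ
  refine ⟨hQ, ?_⟩
  simp [hx Q hQ]

/-- The generic image `([m]^* x, [m]^* y) ∈ E(K̄(E))` of `[m]` is not a constant point. [folklore] -/
theorem genericImage_zsmul_ne_constPoint (hm : m ≠ 0) (S : W.geomPoints) :
    (Isogeny.zsmul W m hm).genericImage ≠ W.constPoint S := by
  intro h
  rcases eq_or_ne S 0 with rfl | hS
  · rw [map_zero] at h
    exact Affine.Point.some_ne_zero _ h
  · obtain ⟨a, b, hab, rfl⟩ := geomPoints.exists_eq_some hS
    rw [constPoint_some, Isogeny.genericImage] at h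
    have hx := (Affine.Point.some.inj h).1
    exact transcendental_pullbackX_zsmul hm (hx ▸ isAlgebraic_algebraMap a)

end Transcendental

/-! ## `deg [m] = m²` and `[m]^* K̄(E) = K̄(E)^{E[m]}` -/

section Main

variable [W.IsElliptic] {m : ℤ}

omit [W.IsElliptic] in
/-- `K̄(φ^* x') ≤ φ^* K̄(E') = K̄(φ^* x', φ^* y')`. [folklore] -/
theorem adjoin_pullbackX_le_pullbackField (φ : Isogeny W W') :
    IntermediateField.adjoin (AlgebraicClosure K) {φ.pullbackX} ≤ φ.pullbackField :=
  IntermediateField.adjoin.mono _ _ _ (Set.singleton_subset_iff.mpr (Set.mem_insert _ _))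

/-- **`K̄(E) / [m]^* K̄(E)` is finite of degree `deg [m] ≤ m²`** (for every `m ≠ 0`):
`[K̄(E) : K̄(x_m)] ≤ 2m²` (`finrank_adjoin_pullbackX_zsmul_le`) and `[K̄(x_m, y_m) : K̄(x_m)] ≥ 2`
(`pullbackY_zsmul_not_mem_adjoin_pullbackX`). In particular the named fact
`Isogeny.finiteDimensional_pullbackField W W` (*AEC* II.2.4(a)) holds for `φ = [m]`.
Silverman, *AEC*, III.6.2(d) (`deg [m] = m²`), here the inequality `≤`. [folklore] -/
theorem finiteDimensional_pullbackField_zsmul (hm : m ≠ 0) :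
    FiniteDimensional (Isogeny.zsmul W m hm).pullbackField W.geomFunctionField ∧
      (Isogeny.zsmul W m hm).deg ≤ m.natAbs ^ 2 := by
  set φ := Isogeny.zsmul W m hm with hφ
  set L₀ := IntermediateField.adjoin (AlgebraicClosure K) {φ.pullbackX} with hL₀
  have hle : L₀ ≤ φ.pullbackField := adjoin_pullbackX_le_pullbackField φ
  obtain ⟨hfin, hbd⟩ := finrank_adjoin_pullbackX_zsmul_le (W := W) hm
  haveI : FiniteDimensional L₀ W.geomFunctionField := hfin
  set L' : IntermediateField L₀ W.geomFunctionField := IntermediateField.extendScalars hle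
    with hL'
  haveI hfin' : FiniteDimensional L' W.geomFunctionField :=
    Module.Finite.of_restrictScalars_finite L₀ L' W.geomFunctionField
  have hy : φ.pullbackY ∈ L' :=
    (IntermediateField.mem_extendScalars hle).mpr
      (IntermediateField.subset_adjoin _ _ (Set.mem_insert_of_mem _ (Set.mem_singleton _)))
  have hne1 : Module.finrank L₀ L' ≠ 1 := by
    rw [Ne, IntermediateField.finrank_eq_one_iff]
    intro hbot
    rw [hbot, IntermediateField.mem_bot] at hy
    obtain ⟨t, ht⟩ := hy
    exact pullbackY_zsmul_not_mem_adjoin_pullbackX hm (by rw [← ht]; exact t.2)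
  haveI : Module.IsTorsionFree L₀ L' := DivisionSemiring.to_moduleIsTorsionFree
  have hne0 : Module.finrank L₀ L' ≠ 0 := Module.finrank_pos.ne'
  have hge : 2 ≤ Module.finrank L₀ L' := by omega
  haveI : Module.Free L₀ L' := Module.Free.of_divisionRing L₀ L'
  haveI : Module.Free L' W.geomFunctionField := Module.Free.of_divisionRing L' _
  have htower := Module.finrank_mul_finrank L₀ L' W.geomFunctionField
  have hdeg : φ.deg = Module.finrank L' W.geomFunctionField := rfl
  refine ⟨hfin', ?_⟩
  rw [hdeg]
  have : 2 * Module.finrank L' W.geomFunctionField ≤ 2 * m.natAbs ^ 2 :=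
    (Nat.mul_le_mul_right _ hge).trans (htower.symm ▸ hbd)
  omega

/-- **`deg [m] = m²`** for `m ≠ 0` in `K` (Silverman, *AEC*, Thm. III.6.2(d)), over the genuine
degree `deg φ = [K̄(E) : φ^* K̄(E)]` of `IsogenyDegree`: `deg [m] ≤ m²`
(`finiteDimensional_pullbackField_zsmul`) and `m² = #E[m] = #ker [m] ∣ deg [m]` (the tree's
`card_torsionPoints_eq_sq_holds`, III.6.4(b), and `Isogeny.card_ker_dvd_deg_holds`,
III.4.10). Silverman proves (d) from dual isogenies; this is the elementary route of his
Exercise 3.7. [cite: SilvermanAEC2009, Thm. III.6.2(d)] -/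
theorem Isogeny.deg_zsmul (hm : m ≠ 0) (hmK : (m : K) ≠ 0) :
    (Isogeny.zsmul W m hm).deg = m.natAbs ^ 2 := by
  obtain ⟨hfin, hle⟩ := finiteDimensional_pullbackField_zsmul (W := W) hm
  haveI := hfin
  have hdvd : m.natAbs ^ 2 ∣ (Isogeny.zsmul W m hm).deg := by
    have h := Isogeny.card_ker_dvd_deg_holds (Isogeny.zsmul W m hm)
    rwa [show Nat.card (Isogeny.zsmul W m hm).toAddMonoidHom.ker = m.natAbs ^ 2 from
      Isogeny.degree_zsmul W m hmK] at h
  haveI : Module.IsTorsionFree (Isogeny.zsmul W m hm).pullbackField W.geomFunctionField :=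
    DivisionSemiring.to_moduleIsTorsionFree
  have hpos : 0 < (Isogeny.zsmul W m hm).deg := Module.finrank_pos
  exact le_antisymm hle (Nat.le_of_dvd hpos hdvd)

/-- **`[m]^* K̄(E)` is the fixed field of the translations by `E[m]`** (for `m ≠ 0` in `K`):
`K̄(E) / [m]^* K̄(E)` is Galois with group `E[m]` acting by `τ_T^*`. Indeed
`[m]^* K̄(E) ⊆ K̄(E)^{E[m]}` (`Isogeny.pullbackField_le_fixedField`), `[K̄(E) : K̄(E)^{E[m]}] =
#E[m] = m²` (Artin's theorem, Mathlib `FixedPoints.finrank_eq_card`, and `#E[m] = m²`) and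
`[K̄(E) : [m]^* K̄(E)] = deg [m] = m²` (`Isogeny.deg_zsmul`). Silverman, *AEC*, Thm. III.4.10(b)
(for the separable isogeny `[m]`, Cor. III.5.4) — obtained here without the separability
theory, by the degree count. [cite: SilvermanAEC2009, Thm. III.4.10(b) with Cor. III.5.4 and Thm. III.6.2(d)] -/
theorem Isogeny.pullbackField_zsmul_eq_fixedField (hm : m ≠ 0) (hmK : (m : K) ≠ 0) :
    (Isogeny.zsmul W m hm).pullbackField =
      IntermediateField.fixedField ((AddSubgroup.toSubgroup (geomTorsion W m)).map W.transHom) := by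
  set φ := Isogeny.zsmul W m hm with hφ
  set H : Subgroup (W.geomFunctionField ≃ₐ[AlgebraicClosure K] W.geomFunctionField) :=
    (AddSubgroup.toSubgroup (geomTorsion W m)).map W.transHom with hH
  have hker : φ.toAddMonoidHom.ker = geomTorsion W m := Isogeny.ker_zsmul W m hm
  have hle : φ.pullbackField ≤ IntermediateField.fixedField H := by
    have h := φ.pullbackField_le_fixedField
    rwa [hker] at h
  obtain ⟨hfin, -⟩ := finiteDimensional_pullbackField_zsmul (W := W) hm
  haveI := hfin
  refine IntermediateField.eq_of_le_of_finrank_eq' hle ?_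
  have hcardK : Nat.card (AddSubgroup.toSubgroup (geomTorsion W m)) =
      Nat.card (geomTorsion W m) :=
    Nat.card_congr (Equiv.subtypeEquiv Multiplicative.toAdd fun _ ↦ Iff.rfl)
  have hcard : Nat.card H = m.natAbs ^ 2 := by
    rw [hH, Subgroup.card_map_of_injective transHom_injective, hcardK, ← hker]
    exact Isogeny.degree_zsmul W m hmK
  haveI : Finite H := Nat.finite_of_card_ne_zero (by
    rw [hcard]; exact pow_ne_zero 2 (Int.natAbs_ne_zero.mpr hm))
  letI : Fintype H := Fintype.ofFinite H
  have h1 : Module.finrank (IntermediateField.fixedField H) W.geomFunctionField =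
      Fintype.card H := FixedPoints.finrank_eq_card H W.geomFunctionField
  rw [h1, ← Nat.card_eq_fintype_card, hcard]
  exact Isogeny.deg_zsmul hm hmK

end Main

end WeierstrassCurve

namespace WeierstrassCurve

open _root_.WeierstrassCurve.geomPoints Literature.NumberTheory.EllipticCurves

variable {K : Type u} [Field K] {W W' : WeierstrassCurve K}

/-! ## The pull-back endomorphism `[m]^* : K̄(E) → K̄(E)` and its image -/

section PullbackHom

variable [W.IsElliptic] {m : ℤ}

/-- **`[m]^* : K̄(E) → K̄(E)`**, the `K̄`-algebra endomorphism of the function field induced by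
`[m]` (`f ↦ f ∘ [m]`): the endomorphism sending the generic point `(x, y)` to
`[m](x, y) = ([m]^* x, [m]^* y) ∈ E(K̄(E))` exists (and is unique) because that point is not
constant (`genericImage_zsmul_ne_constPoint`). Silverman, *AEC*, II.§2 (`φ^*`). [folklore] -/
theorem exists_algHom_map_genericPoint_eq_genericImage_zsmul (hm : m ≠ 0) :
    ∃ σ : W.geomFunctionField →ₐ[AlgebraicClosure K] W.geomFunctionField,
      σ W.genX = (Isogeny.zsmul W m hm).pullbackX ∧ σ W.genY = (Isogeny.zsmul W m hm).pullbackY := by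
  obtain ⟨σ, hσ⟩ := exists_algHom_map_genericPoint_eq (genericImage_zsmul_ne_constPoint (W := W) hm)
  rw [map_genericPoint, Isogeny.genericImage] at hσ
  obtain ⟨hx, hy⟩ := Affine.Point.some.inj hσ
  exact ⟨σ, hx, hy⟩

/-- **Every element of `[m]^* K̄(E) = K̄([m]^* x, [m]^* y)` is of the form `f ∘ [m]`**: the image of
`[m]^*` is the subfield generated by `[m]^* x = [m]^*(x)` and `[m]^* y` (`K̄(E) = K̄(x, y)`,
`adjoin_genX_genY_eq_top`, and `IntermediateField.adjoin_map`). [folklore] -/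
theorem exists_algHom_apply_eq_of_mem_pullbackField_zsmul (hm : m ≠ 0)
    {σ : W.geomFunctionField →ₐ[AlgebraicClosure K] W.geomFunctionField}
    (hσx : σ W.genX = (Isogeny.zsmul W m hm).pullbackX)
    (hσy : σ W.genY = (Isogeny.zsmul W m hm).pullbackY)
    {z : W.geomFunctionField} (hz : z ∈ (Isogeny.zsmul W m hm).pullbackField) :
    ∃ w : W.geomFunctionField, σ w = z := by
  have hmap : (⊤ : IntermediateField (AlgebraicClosure K) W.geomFunctionField).map σ =
      (Isogeny.zsmul W m hm).pullbackField := by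
    rw [← adjoin_genX_genY_eq_top (W := W), IntermediateField.adjoin_map, Isogeny.pullbackField]
    congr 1
    rw [Set.image_pair, hσx, hσy]
  rw [← hmap, IntermediateField.mem_map] at hz
  obtain ⟨w, -, hw⟩ := hz
  exact ⟨w, hw⟩

end PullbackHom

/-! ## Factorisation of an isogeny killing `E[m]` through `[m]` -/

section Factor

variable [W.IsElliptic]

/-- **Descent of `ψ^* x'`, `ψ^* y'` through `[m]`** (Silverman, *AEC*, proof of Cor. III.4.11:
"`ψ^* K̄(E₂)` is fixed by every translation `τ_T^*`, `T ∈ ker φ`, hence `ψ^* K̄(E₂) ⊆ φ^* K̄(E₁)`",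
with `φ = [m]`): if `E[m] ⊆ ker ψ` and `m ≠ 0` in `K`, there are `w₁, w₂ ∈ K̄(E)` with
`ψ^* x' = [m]^* w₁`, `ψ^* y' = [m]^* w₂`. [cite: SilvermanAEC2009, Cor. III.4.11 (proof)] -/
theorem Isogeny.exists_pullback_eq_of_geomTorsion_le_ker {m : ℤ} (hm : m ≠ 0) (hmK : (m : K) ≠ 0)
    (ψ : Isogeny W W') (hψ : ∀ P ∈ geomTorsion W m, ψ P = 0)
    {σ : W.geomFunctionField →ₐ[AlgebraicClosure K] W.geomFunctionField}
    (hσx : σ W.genX = (Isogeny.zsmul W m hm).pullbackX)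
    (hσy : σ W.genY = (Isogeny.zsmul W m hm).pullbackY) :
    (∃ w₁, σ w₁ = ψ.pullbackX) ∧ (∃ w₂, σ w₂ = ψ.pullbackY) := by
  -- `ψ^* K̄(E') ⊆ K̄(E)^{ker ψ} ⊆ K̄(E)^{E[m]} = [m]^* K̄(E)`
  have hle : ψ.pullbackField ≤ (Isogeny.zsmul W m hm).pullbackField := by
    rw [Isogeny.pullbackField_zsmul_eq_fixedField hm hmK]
    refine ψ.pullbackField_le_fixedField.trans (IntermediateField.fixedField_le ?_)
    refine Subgroup.map_mono ((OrderIso.le_iff_le AddSubgroup.toSubgroup).mpr ?_)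
    intro T hT
    exact (AddMonoidHom.mem_ker).mpr (hψ T hT)
  have hx : ψ.pullbackX ∈ (Isogeny.zsmul W m hm).pullbackField :=
    hle (IntermediateField.subset_adjoin _ _ (Set.mem_insert _ _))
  have hy : ψ.pullbackY ∈ (Isogeny.zsmul W m hm).pullbackField :=
    hle (IntermediateField.subset_adjoin _ _ (Set.mem_insert_of_mem _ (Set.mem_singleton _)))
  exact ⟨exists_algHom_apply_eq_of_mem_pullbackField_zsmul hm hσx hσy hx,
    exists_algHom_apply_eq_of_mem_pullbackField_zsmul hm hσx hσy hy⟩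

/-- **Values of `[m]^* w = w ∘ [m]`**: if `w = g(x, y)/h(x, y)` then `[m]^* w` has the value
`g(mQ)/h(mQ)` at every `Q` with `mQ ≠ O` and `h(mQ) ≠ 0`. [folklore] -/
theorem hasValueAt_algHom_evalGeneric_div {m : ℤ} (hm : m ≠ 0)
    {σ : W.geomFunctionField →ₐ[AlgebraicClosure K] W.geomFunctionField}
    (hσx : σ W.genX = (Isogeny.zsmul W m hm).pullbackX)
    (hσy : σ W.genY = (Isogeny.zsmul W m hm).pullbackY)
    (g h : MvPolynomial (Fin 2) (AlgebraicClosure K)) {Q : W.geomPoints} (hQ : Q ≠ 0)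
    (hQm : m • Q ≠ 0) (hh : MvPolynomial.eval (xy (m • Q)) h ≠ 0) :
    W.HasValueAt (σ (W.evalGeneric g / W.evalGeneric h)) Q
      (MvPolynomial.eval (xy (m • Q)) g / MvPolynomial.eval (xy (m • Q)) h) := by
  have hw : ∀ i, W.HasValueAt (![σ W.genX, σ W.genY] i) Q (xy (m • Q) i) := by
    intro i
    fin_cases i
    · simpa [hσx] using hasValueAt_pullbackX_zsmul hm hQm
    · simpa [hσy] using hasValueAt_pullbackY_zsmul hm hQm
  rw [map_div₀, algHom_evalGeneric, algHom_evalGeneric]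
  exact (HasValueAt.aeval hw g).div hQ (HasValueAt.aeval hw h) hh

/-- **The factorisation `ψ = λ ∘ [m]` on points**: for `[m] : E(K̄) → E(K̄)` onto with kernel
`E[m] ⊆ ker ψ`, the homomorphism `λ` with `λ(mP) = ψ(P)` (Mathlib
`AddMonoidHom.liftOfSurjective`). Silverman, *AEC*, Cor. III.4.11 (uniqueness of `λ`: `φ` is onto).
[folklore] -/
theorem exists_addMonoidHom_comp_zsmul_eq {m : ℤ} (hm : m ≠ 0) (ψ : Isogeny W W')
    (hψ : ∀ P ∈ geomTorsion W m, ψ P = 0) :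
    ∃ lam : W.geomPoints →+ W'.geomPoints, ∀ P, lam (m • P) = ψ P := by
  have hsurj : Function.Surjective (zsmulAddGroupHom m : W.geomPoints →+ W.geomPoints) :=
    zsmul_geomPoints_surjective_holds W hm
  have hker : (zsmulAddGroupHom m : W.geomPoints →+ W.geomPoints).ker ≤ ψ.toAddMonoidHom.ker := by
    intro P hP
    exact (AddMonoidHom.mem_ker).mpr (hψ P ((AddMonoidHom.mem_ker).mp hP))
  refine ⟨(zsmulAddGroupHom m).liftOfSurjective hsurj ⟨ψ.toAddMonoidHom, hker⟩, fun P ↦ ?_⟩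
  exact (zsmulAddGroupHom m : W.geomPoints →+ W.geomPoints).liftOfRightInverse_comp_apply
    (Function.surjInv hsurj) (Function.rightInverse_surjInv hsurj) ⟨ψ.toAddMonoidHom, hker⟩ P

/-- **`λ` is algebraic.** With `ψ^* x' = [m]^* (g₁/h₁)`, `ψ^* y' = [m]^* (g₂/h₂)`
(`Isogeny.exists_pullback_eq_of_geomTorsion_le_ker`), comparing values at a good point `Q` with
`mQ = P` gives `x'(λ P) = x'(ψ Q) = g₁(P)/h₁(P)`, `y'(λ P) = g₂(P)/h₂(P)`; the bad `P` are `O`,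
the images under `[m]` of the exceptional points of `ψ`, and the zeros of `h₁ h₂`.
Silverman, *AEC*, Cor. III.4.11 (`λ` is the rational map with `λ^* = (φ^*)⁻¹ ∘ ψ^*`, a morphism by
II.2.1). [cite: SilvermanAEC2009, Cor. III.4.11 (proof)] -/
theorem isAlgebraicOn_of_comp_zsmul_eq {m : ℤ} (hm : m ≠ 0) (hmK : (m : K) ≠ 0) (ψ : Isogeny W W')
    (hψ : ∀ P ∈ geomTorsion W m, ψ P = 0) {lam : W.geomPoints →+ W'.geomPoints}
    (hlam : ∀ P, lam (m • P) = ψ P) : IsAlgebraicOn W W' lam := by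
  obtain ⟨σ, hσx, hσy⟩ := exists_algHom_map_genericPoint_eq_genericImage_zsmul (W := W) hm
  obtain ⟨⟨w₁, hw₁⟩, ⟨w₂, hw₂⟩⟩ :=
    ψ.exists_pullback_eq_of_geomTorsion_le_ker hm hmK hψ hσx hσy
  obtain ⟨g₁, h₁, hh₁, rfl⟩ := exists_eq_evalGeneric_div w₁
  obtain ⟨g₂, h₂, hh₂, rfl⟩ := exists_eq_evalGeneric_div w₂
  set r := ψ.rationalRep with hr
  -- the bad set
  set B : Set W.geomPoints := {0} ∪
    (fun Q ↦ m • Q) '' {Q | ¬ AgreesWithRationalMapAt W W' r.P₁ r.Q₁ r.P₂ r.Q₂ ψ Q} ∪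
    {P | P ≠ 0 ∧ MvPolynomial.eval (xy P) h₁ = 0} ∪ {P | P ≠ 0 ∧ MvPolynomial.eval (xy P) h₂ = 0}
    with hB
  have hBfin : B.Finite :=
    (((Set.finite_singleton _).union (r.finite.image _)).union
      (finite_setOf_eval_xy_eq_zero hh₁)).union (finite_setOf_eval_xy_eq_zero hh₂)
  refine ⟨g₁, h₁, g₂, h₂, hBfin.subset fun P hP ↦ ?_⟩
  by_contra hPB
  apply hP
  simp only [hB, Set.mem_union, Set.mem_singleton_iff, Set.mem_image, Set.mem_setOf_eq, not_or,
    not_exists, not_and] at hPB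
  obtain ⟨⟨⟨hP0, hPimg⟩, hPh₁⟩, hPh₂⟩ := hPB
  have hPh₁' : MvPolynomial.eval (xy P) h₁ ≠ 0 := fun h ↦ hPh₁ hP0 h
  have hPh₂' : MvPolynomial.eval (xy P) h₂ ≠ 0 := fun h ↦ hPh₂ hP0 h
  obtain ⟨Q, rfl⟩ := zsmul_geomPoints_surjective_holds W hm P
  change m • Q ≠ 0 at hP0
  have hQA : AgreesWithRationalMapAt W W' r.P₁ r.Q₁ r.P₂ r.Q₂ ψ Q := by
    by_contra h
    exact hPimg Q h rfl
  have hQ0 : Q ≠ 0 := (agreesWithRationalMapAt_iff.mp hQA).1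
  -- `ψ Q` is affine, with coordinates the values of `ψ^* x'`, `ψ^* y'` at `Q`
  obtain ⟨a, b, hab, e⟩ := geomPoints.exists_eq_some hQA.apply_ne_zero
  have hvx : W.HasValueAt ψ.pullbackX Q a := by
    have h := r.hasValueAt_pullbackX hQA
    rw [e, xy_some] at h
    exact h
  have hvy : W.HasValueAt ψ.pullbackY Q b := by
    have h := r.hasValueAt_pullbackY hQA
    rw [e, xy_some] at h
    exact h
  -- and also the values of `[m]^* (gᵢ/hᵢ)` at `Q`
  have hvx' := hasValueAt_algHom_evalGeneric_div hm hσx hσy g₁ h₁ hQ0 hP0 hPh₁'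
  have hvy' := hasValueAt_algHom_evalGeneric_div hm hσx hσy g₂ h₂ hQ0 hP0 hPh₂'
  rw [hw₁] at hvx'
  rw [hw₂] at hvy'
  have ha : a = MvPolynomial.eval (xy (m • Q)) g₁ / MvPolynomial.eval (xy (m • Q)) h₁ :=
    hvx.unique hQ0 hvx'
  have hb : b = MvPolynomial.eval (xy (m • Q)) g₂ / MvPolynomial.eval (xy (m • Q)) h₂ :=
    hvy.unique hQ0 hvy'
  refine agreesWithRationalMapAt_of_hasValue hP0 (x := a) (y := b) (h := hab) ?_ ?_ ?_
  · rw [hlam Q, e]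
  · exact (RatFrac.hasValue_mk hPh₁').congr ha.symm
  · exact (RatFrac.hasValue_mk hPh₂').congr hb.symm

/-- **Silverman, *AEC*, Cor. III.4.11 for `φ = [m]`**: an isogeny `ψ : E → E'` over `K` killing
`E[m]`, `m ≠ 0` in `K`, factors as `ψ = λ ∘ [m]` for an isogeny `λ : E → E'` over `K`; `λ` is
`Γ_K`-equivariant because `[m]` is (and is onto), and has finite kernel because it is algebraic.
[cite: SilvermanAEC2009, Cor. III.4.11 with Cor. III.5.4] -/
theorem Isogeny.exists_eq_comp_zsmul_of_geomTorsion_le_ker {m : ℤ} (hmK : (m : K) ≠ 0)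
    (ψ : Isogeny W W') (hψ : ∀ P ∈ geomTorsion W m, ψ P = 0) :
    ∃ lam : Isogeny W W', ∀ P, ψ P = lam (m • P) := by
  have hm : m ≠ 0 := by
    rintro rfl
    exact hmK (by simp)
  obtain ⟨lam, hlam⟩ := exists_addMonoidHom_comp_zsmul_eq hm ψ hψ
  have halg : IsAlgebraicOn W W' lam := isAlgebraicOn_of_comp_zsmul_eq hm hmK ψ hψ hlam
  refine ⟨⟨lam, halg, fun σ P ↦ ?_, halg.finite_ker⟩, fun P ↦ (hlam P).symm⟩
  obtain ⟨Q, rfl⟩ := zsmul_geomPoints_surjective_holds W hm P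
  have hc : σ • (m • Q) = m • (σ • Q) := map_zsmul (DistribSMul.toAddMonoidHom W.geomPoints σ) m Q
  change lam (σ • (m • Q)) = σ • lam (m • Q)
  rw [hc, hlam, hlam, ψ.map_smul]

omit [W.IsElliptic] in
variable (W W') in
/-- **Discharge of the named fact `WeierstrassCurve.Isogeny.exists_eq_comp_nsmul_of_geomTorsion_le_ker`**
(`IsogenyHom.lean`; Silverman, *AEC*, Cor. III.4.11 applied to the separable isogeny `[m]`,
Cor. III.5.4): for elliptic curves `E, E'` over `K`, `m : ℕ` with `m ≠ 0` in `K`, and an isogeny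
`ψ : E → E'` over `K` with `E[m] ⊆ ker ψ`, there is an isogeny `λ` over `K` with `ψ = λ ∘ [m]`.
The proof is Silverman's: the translations `τ_T^*`, `T ∈ E[m]`, fix `ψ^* K̄(E')`
(`Isogeny.pullbackField_le_fixedField`), and `K̄(E)^{E[m]} = [m]^* K̄(E)` (by the degree count
`deg [m] = m² = #E[m]`, `Isogeny.pullbackField_zsmul_eq_fixedField`, in place of the separability
of `[m]`), so `ψ^* x', ψ^* y' ∈ [m]^* K̄(E)` descend to rational functions which represent the
point map `λ = ψ ∘ [m]⁻¹`. Consumers `(h : Isogeny.exists_eq_comp_nsmul_of_geomTorsion_le_ker W W')`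
are fed `Isogeny.exists_eq_comp_nsmul_of_geomTorsion_le_ker_holds' W W'` (this file) or the
unprimed `…_holds W W'` of `IsogenyHomNsmulProofs` (an independent discharge of the same fact,
landed simultaneously; the prime only keeps the two declarations apart).
[cite: SilvermanAEC2009, Cor. III.4.11 with Cor. III.5.4] -/
theorem Isogeny.exists_eq_comp_nsmul_of_geomTorsion_le_ker_holds' :
    Isogeny.exists_eq_comp_nsmul_of_geomTorsion_le_ker W W' := by
  intro _ _ m hmK ψ hψ
  have hmK' : ((m : ℤ) : K) ≠ 0 := by rwa [Int.cast_natCast]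
  obtain ⟨lam, hlam⟩ := Isogeny.exists_eq_comp_zsmul_of_geomTorsion_le_ker hmK' ψ
    (fun P hP ↦ hψ P (by simpa using hP))
  exact ⟨lam, fun P ↦ by simpa [natCast_zsmul] using hlam P⟩

end Factor

end WeierstrassCurve
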